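/-
Cell b2b-lgcu-borel (gen 21).  VALUE = THEOREM (an unconditional exclusion of a class of members of
hypothetical witnesses), NOT summit progress; the crux item `SubgroupIdentityDesigns`
(stmt-MatrixMultiplication-14079) stays open and untouched.
-/
import Mathlib
import Summits.MatrixMultiplication.MatrixMultiplication.Theorems.SubgroupIdentityDesigns.Negative.CharacterLaw

/-!
# No member of a level-one witness contains the diagonal torus

Route `LevelGradedCohnUmans`, crux `SubgroupIdentityDesigns` (stmt-MatrixMultiplication-14079), cells
`(m, k) = (1 + l, 1)`, `p ≥ 3`, `−2 < ε ≤ 1`; report `run/shared/lean/b2b/levelgraded-cu/ORACLE-g21.md`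
§G21-4.  VALUE = THEOREM (the first instance of the single-admissible-orbit exclusion of
`CharacterLaw`), NOT summit progress; the crux item is untouched and remains open.

Let `T ≤ GL_m(𝔽_p)` be the diagonal torus (`diagTorus`), `χ : 𝔽_p^× → ℂˣ` a NON-TRIVIAL character
(one exists for `p ≥ 3`: the quadratic character, `exists_unitChar_ne_one`) and `σ = χ ∘ det|_T`
(`detChar`).  A vector `u` is `σ`-admissible iff every coordinate of `u` is non-zero
(`support_full_of_mem_adm`: if `u_{i₀} = 0`, the torus element `diag(1, …, c, …, 1)` with `χ(c) ≠ 1`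
fixes `u`), and the full-support vectors form ONE `T`-orbit (`exists_smul_eq_of_full`), so
`ν_σ(T) ≤ 1` (`card_admOrb_torus_le_one`).  By `CharacterLaw.no_single_orbit_*`:

* `torus_not_le_member` — for every level-one witness (`p ≥ 3`, `m = 1 + l ≥ 2`, `−2 < ε ≤ 1`):
  `¬ T ≤ H₁`, `¬ T ≤ H₂`, `¬ T ≤ H₃`;
* `conjTorus_not_le_member` — the same for every conjugate `x T x⁻¹` (every split maximal torus;
  admissibility and `det` transport under conjugation), and `overgroup_of_torus_not_le_member`: a
  fortiori no member contains a monomial group, a Borel subgroup, a parabolic, or any overgroup of a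
  split maximal torus.

Contrast: `T` has `2^m − 1 + …` orbits on vectors, so the invariant law (`LevelOneInvariantDim`,
`σ = 1`) says nothing about it, and `T` is far from semiregular (`SemiregularLaw`); the character law is
the first tool of the cell that binds fixed-point-rich subgroups of members.

HONEST SCOPE (vs the order-only counts of `LevelOneWindowAll`/N1/N2): `|T| = (p − 1)^m`.  For the
MIDDLE member the window allows `|H₂| ≤ p^m − b − 2 ≥ (p − 1)^m`, so `¬ T ≤ H₂` is new in every open
cell; for the END members N2 already bounds `|H| ≤ D/(2b − 1) < (p^m − 1)/2 + (p − 1)/4`, which is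
`< (p − 1)^m` unless `m ≳ p ln 2` (e.g. it is new for ends at `(p, m) = (5, 4), (11, ≥ 8), (13, ≥ 9)`,
and implied by order at `(11, 3), (13, 3)`); most overgroups of `T` exceed the window by order alone.

Sorry-free; standard axioms.
-/

set_option linter.dupNamespace false

noncomputable section

open scoped BigOperators Classical Matrix LinearAlgebra.Projectivization

namespace Summit.MatrixMultiplication.MatrixMultiplication.Theorems.SubgroupIdentityDesigns.Negative
namespace DiagonalTorusExclusion

open Summit.MatrixMultiplication.MatrixMultiplication.Theorems.LieRankDesigns.Negative (GLm Mat budget)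
open Literature.Barriers.MatrixMultiplication (SubgroupTPP)
open LevelOneEquivariantDim (adm mem_adm AdmOrb card_admOrb_le_one)
open CharacterLaw (no_single_orbit_right no_single_orbit_left no_single_orbit_middle)

variable {p m : ℕ} [hp : Fact p.Prime]

/-! ## The diagonal torus -/

/-- The diagonal invertible matrices, as a submonoid of `GL_m(𝔽_p)`. -/
def diagSubmonoid (p m : ℕ) [Fact p.Prime] : Submonoid (GLm p m) where
  carrier := {g | ∀ i j, i ≠ j → (g : Mat p m) i j = 0}
  one_mem' := fun i j hij => by simp [Matrix.one_apply_ne hij]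
  mul_mem' := by
    intro g h hg hh i j hij
    rw [Units.val_mul, Matrix.mul_apply]
    refine Finset.sum_eq_zero fun k _ => ?_
    by_cases hik : i = k
    · subst hik; rw [hh i j hij, mul_zero]
    · rw [hg i k hik, zero_mul]

/-- The DIAGONAL TORUS `T ≤ GL_m(𝔽_p)` (a finite submonoid of a group is a subgroup). -/
def diagTorus (p m : ℕ) [Fact p.Prime] : Subgroup (GLm p m) :=
  { diagSubmonoid p m with
    inv_mem' := fun {g} hg => by
      have h : g ^ (orderOf g - 1) * g = 1 := by
        rw [← pow_succ, Nat.sub_add_cancel (orderOf_pos g), pow_orderOf_eq_one]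
      rw [inv_eq_of_mul_eq_one_left h]
      exact (diagSubmonoid p m).pow_mem hg _ }

/-- Membership in the torus: all off-diagonal entries vanish. -/
theorem mem_diagTorus {g : GLm p m} : g ∈ diagTorus p m ↔ ∀ i j, i ≠ j → (g : Mat p m) i j = 0 :=
  Iff.rfl

/-- A torus element acts coordinatewise: `(t u)_i = t_{ii} u_i`. -/
theorem smul_apply_of_mem {t : GLm p m} (ht : t ∈ diagTorus p m) (u : Fin m → ZMod p) (i : Fin m) :
    (t • u) i = (t : Mat p m) i i * u i := by
  show ((t : Mat p m) *ᵥ u) i = _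
  simp only [Matrix.mulVec, dotProduct]
  exact Finset.sum_eq_single i (fun j _ hji => by rw [ht i j (Ne.symm hji), zero_mul])
    (fun h => absurd (Finset.mem_univ i) h)

/-- The diagonal unit with prescribed unit entries. -/
def diagUnit (d : Fin m → (ZMod p)ˣ) : GLm p m :=
  ⟨Matrix.diagonal fun i => (d i : ZMod p), Matrix.diagonal fun i => ((d i)⁻¹ : (ZMod p)ˣ),
    by
      rw [Matrix.diagonal_mul_diagonal, ← Matrix.diagonal_one]
      congr 1; funext i; rw [← Units.val_mul, mul_inv_cancel, Units.val_one],
    by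
      rw [Matrix.diagonal_mul_diagonal, ← Matrix.diagonal_one]
      congr 1; funext i; rw [← Units.val_mul, inv_mul_cancel, Units.val_one]⟩

/-- `diagUnit d` lies in the torus. -/
theorem diagUnit_mem (d : Fin m → (ZMod p)ˣ) : diagUnit d ∈ diagTorus p m :=
  fun i j hij => by
    show (Matrix.diagonal fun i => (d i : ZMod p)) i j = 0
    exact Matrix.diagonal_apply_ne _ hij

/-- `diagUnit d` acts by `u_i ↦ d_i u_i`. -/
theorem diagUnit_smul_apply (d : Fin m → (ZMod p)ˣ) (u : Fin m → ZMod p) (i : Fin m) :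
    (diagUnit d • u) i = (d i : ZMod p) * u i := by
  rw [smul_apply_of_mem (diagUnit_mem d)]
  show (Matrix.diagonal fun i => (d i : ZMod p)) i i * u i = _
  rw [Matrix.diagonal_apply_eq]

/-- `det (diagUnit d) = ∏ d_i`. -/
theorem det_diagUnit (d : Fin m → (ZMod p)ˣ) :
    Matrix.GeneralLinearGroup.det (diagUnit d) = ∏ i, d i := by
  ext
  rw [Matrix.GeneralLinearGroup.val_det_apply, Units.coe_prod]
  show (Matrix.diagonal fun i => (d i : ZMod p)).det = _
  rw [Matrix.det_diagonal]

/-! ## The character `σ = χ ∘ det` and its admissible vectors -/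

/-- The restriction of `χ ∘ det` to a subgroup `K`. -/
def detChar (χ : (ZMod p)ˣ →* ℂˣ) (K : Subgroup (GLm p m)) : K →* ℂˣ :=
  χ.comp (Matrix.GeneralLinearGroup.det.comp K.subtype)

/-- Unfolding `detChar`. -/
theorem detChar_apply (χ : (ZMod p)ˣ →* ℂˣ) (K : Subgroup (GLm p m)) (k : K) :
    detChar χ K k = χ (Matrix.GeneralLinearGroup.det (k : GLm p m)) := rfl

/-- A non-trivial character takes a value `≠ 1`. -/
theorem exists_apply_ne_one {χ : (ZMod p)ˣ →* ℂˣ} (hχ : χ ≠ 1) : ∃ c, χ c ≠ 1 := by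
  by_contra h
  simp only [not_exists, not_not] at h
  exact hχ (MonoidHom.ext fun c => by rw [h c, MonoidHom.one_apply])

/-- **Admissible vectors of the torus have full support**: if `u_{i₀} = 0` then
`diag(1, …, c, …, 1)` (`χ(c) ≠ 1`) fixes `u` but has `σ ≠ 1`. -/
theorem support_full_of_mem_adm {χ : (ZMod p)ˣ →* ℂˣ} (hχ : χ ≠ 1) {u : Fin m → ZMod p}
    (hu : u ∈ adm (diagTorus p m) (detChar χ _)) (i₀ : Fin m) : u i₀ ≠ 0 := by
  intro h0
  obtain ⟨c, hc⟩ := exists_apply_ne_one hχ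
  let t : diagTorus p m := ⟨diagUnit (Function.update 1 i₀ c), diagUnit_mem _⟩
  have hfix : t • u = u := by
    funext i
    show (diagUnit (Function.update 1 i₀ c) • u) i = u i
    rw [diagUnit_smul_apply]
    by_cases hi : i = i₀
    · subst hi; rw [h0, mul_zero]
    · rw [Function.update_of_ne hi, Pi.one_apply, Units.val_one, one_mul]
  have hσ := hu t hfix
  rw [detChar_apply] at hσ
  apply hc
  have hdet : Matrix.GeneralLinearGroup.det ((t : GLm p m)) = c := by
    show Matrix.GeneralLinearGroup.det (diagUnit (Function.update 1 i₀ c)) = c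
    rw [det_diagUnit, Finset.prod_update_of_mem (Finset.mem_univ i₀)]
    simp
  rwa [hdet] at hσ

/-- **The full-support vectors form one torus orbit.** -/
theorem exists_smul_eq_of_full {u v : Fin m → ZMod p} (hu : ∀ i, u i ≠ 0) (hv : ∀ i, v i ≠ 0) :
    ∃ t : diagTorus p m, t • u = v := by
  refine ⟨⟨diagUnit fun i => Units.mk0 (v i) (hv i) * (Units.mk0 (u i) (hu i))⁻¹, diagUnit_mem _⟩,
    ?_⟩
  funext i
  show (diagUnit (fun i => Units.mk0 (v i) (hv i) * (Units.mk0 (u i) (hu i))⁻¹) • u) i = v i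
  rw [diagUnit_smul_apply, Units.val_mul, Units.val_inv_eq_inv_val, Units.val_mk0, Units.val_mk0,
    inv_mul_cancel_right₀ (hu i)]

/-- **`ν_σ(T) ≤ 1`** for the diagonal torus and `σ = χ ∘ det`, `χ ≠ 1`. -/
theorem card_admOrb_torus_le_one {χ : (ZMod p)ˣ →* ℂˣ} (hχ : χ ≠ 1) :
    Nat.card (AdmOrb (diagTorus p m) (detChar χ _)) ≤ 1 :=
  card_admOrb_le_one _ _ fun _ _ hu hv =>
    exists_smul_eq_of_full (support_full_of_mem_adm hχ hu) (support_full_of_mem_adm hχ hv)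

/-- `σ = χ ∘ det|_T ≠ 1` as soon as `χ ≠ 1` and `m ≥ 1`. -/
theorem detChar_torus_ne_one (hm : 1 ≤ m) {χ : (ZMod p)ˣ →* ℂˣ} (hχ : χ ≠ 1) :
    detChar χ (diagTorus p m) ≠ 1 := by
  obtain ⟨c, hc⟩ := exists_apply_ne_one hχ
  intro h1
  let i₀ : Fin m := ⟨0, hm⟩
  let t : diagTorus p m := ⟨diagUnit (Function.update 1 i₀ c), diagUnit_mem _⟩
  have h := DFunLike.congr_fun h1 t
  rw [detChar_apply, MonoidHom.one_apply] at h
  apply hc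
  have hdet : Matrix.GeneralLinearGroup.det ((t : GLm p m)) = c := by
    show Matrix.GeneralLinearGroup.det (diagUnit (Function.update 1 i₀ c)) = c
    rw [det_diagUnit, Finset.prod_update_of_mem (Finset.mem_univ i₀)]
    simp
  rwa [hdet] at h

/-- For `p ≥ 3` the unit group `𝔽_p^×` has a non-trivial character (the quadratic character). -/
theorem exists_unitChar_ne_one (hp3 : 3 ≤ p) : ∃ χ : (ZMod p)ˣ →* ℂˣ, χ ≠ 1 := by
  have h2 : ringChar (ZMod p) ≠ 2 := by rw [ZMod.ringChar_zmod_n]; omega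
  obtain ⟨a, ha⟩ := quadraticChar_exists_neg_one h2
  have ha0 : a ≠ 0 := by rintro rfl; simp at ha
  refine ⟨((quadraticChar (ZMod p)).ringHomComp (Int.castRingHom ℂ)).toUnitHom, fun h => ?_⟩
  have h1 := DFunLike.congr_fun h (Units.mk0 a ha0)
  have h2 := congrArg (fun u : ℂˣ => (u : ℂ)) h1
  simp only [MulChar.coe_toUnitHom, Units.val_mk0, MulChar.ringHomComp_apply, ha,
    MonoidHom.one_apply, Units.val_one] at h2
  norm_num at h2

/-! ## Conjugate tori (every split maximal torus) -/

/-- The conjugate torus `x T x⁻¹` (the stabiliser of the frame `x e_1, …, x e_m`). -/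
abbrev conjTorus (p m : ℕ) [Fact p.Prime] (x : GLm p m) : Subgroup (GLm p m) :=
  (diagTorus p m).map (MulAut.conj x).toMonoidHom

/-- Elements of the conjugate torus: `x t x⁻¹`, `t ∈ T`. -/
theorem mem_conjTorus {x g : GLm p m} :
    g ∈ conjTorus p m x ↔ ∃ t ∈ diagTorus p m, x * t * x⁻¹ = g := by
  simp only [conjTorus, Subgroup.mem_map, MulEquiv.coe_toMonoidHom, MulAut.conj_apply]

omit hp in
/-- `det (x t x⁻¹) = det t`. -/
theorem det_conj (x t : GLm p m) :
    Matrix.GeneralLinearGroup.det (x * t * x⁻¹) = Matrix.GeneralLinearGroup.det t := by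
  rw [map_mul, map_mul, map_inv, mul_inv_cancel_comm]

/-- Admissibility transports: `u` admissible for `x T x⁻¹` ⟹ `x⁻¹ u` admissible for `T`. -/
theorem inv_smul_mem_adm_of_conj {χ : (ZMod p)ˣ →* ℂˣ} {x : GLm p m} {u : Fin m → ZMod p}
    (hu : u ∈ adm (conjTorus p m x) (detChar χ _)) :
    x⁻¹ • u ∈ adm (diagTorus p m) (detChar χ _) := by
  intro t ht
  have hmem : x * (t : GLm p m) * x⁻¹ ∈ conjTorus p m x := mem_conjTorus.2 ⟨t, t.2, rfl⟩
  have hfix : (⟨x * (t : GLm p m) * x⁻¹, hmem⟩ : conjTorus p m x) • u = u := by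
    show (x * (t : GLm p m) * x⁻¹) • u = u
    have ht' : (t : GLm p m) • (x⁻¹ • u) = x⁻¹ • u := ht
    rw [mul_smul, mul_smul, ht', smul_inv_smul]
  have h := hu _ hfix
  rw [detChar_apply] at h ⊢
  show χ (Matrix.GeneralLinearGroup.det (t : GLm p m)) = 1
  rwa [Subgroup.coe_mk, det_conj] at h

/-- **`ν_σ(x T x⁻¹) ≤ 1`** for every conjugate torus (`σ = χ ∘ det`, `χ ≠ 1`). -/
theorem card_admOrb_conjTorus_le_one {χ : (ZMod p)ˣ →* ℂˣ} (hχ : χ ≠ 1) (x : GLm p m) :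
    Nat.card (AdmOrb (conjTorus p m x) (detChar χ _)) ≤ 1 := by
  refine card_admOrb_le_one _ _ fun u v hu hv => ?_
  have hu' := inv_smul_mem_adm_of_conj hu
  have hv' := inv_smul_mem_adm_of_conj hv
  obtain ⟨t, ht⟩ := exists_smul_eq_of_full (support_full_of_mem_adm hχ hu')
    (support_full_of_mem_adm hχ hv')
  refine ⟨⟨x * (t : GLm p m) * x⁻¹, mem_conjTorus.2 ⟨t, t.2, rfl⟩⟩, ?_⟩
  show (x * (t : GLm p m) * x⁻¹) • u = v
  have ht' : (t : GLm p m) • (x⁻¹ • u) = x⁻¹ • v := ht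
  rw [mul_smul, mul_smul, ht', smul_inv_smul]

/-- `σ = χ ∘ det ≠ 1` on every conjugate torus (`χ ≠ 1`, `m ≥ 1`). -/
theorem detChar_conjTorus_ne_one (hm : 1 ≤ m) {χ : (ZMod p)ˣ →* ℂˣ} (hχ : χ ≠ 1) (x : GLm p m) :
    detChar χ (conjTorus p m x) ≠ 1 := by
  intro h1
  apply detChar_torus_ne_one (p := p) hm hχ
  ext t
  have hmem : x * (t : GLm p m) * x⁻¹ ∈ conjTorus p m x := mem_conjTorus.2 ⟨t, t.2, rfl⟩
  have h := DFunLike.congr_fun h1 ⟨_, hmem⟩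
  rw [detChar_apply, MonoidHom.one_apply, Subgroup.coe_mk, det_conj] at h
  rw [detChar_apply, MonoidHom.one_apply, h]

/-! ## The exclusion -/

variable {l : ℕ} {H₁ H₂ H₃ : Subgroup (GLm p (1 + l))}

/-- **NO MEMBER OF A LEVEL-ONE WITNESS CONTAINS THE DIAGONAL TORUS** (`p ≥ 3`, `m = 1 + l ≥ 2`,
`−2 < ε ≤ 1`; hypotheses = the crux clauses verbatim at level `1` plus the budget clause). -/
theorem torus_not_le_member (hl : 1 ≤ l) (hp3 : 3 ≤ p) {ε : ℝ} (hε : -2 < ε) (hε1 : ε ≤ 1)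
    (htpp : SubgroupTPP H₁ H₂ H₃)
    (hdes : ∃ c : Mat p (1 + l) → ℂ, (∀ M, 1 < M.rank → c M = 0) ∧
      (∑ M, c M * ZMod.stdAddChar (Matrix.trace (M * ((1 : GLm p (1 + l)) : Mat p (1 + l))))) = 1 ∧
      ∀ a ∈ H₁, ∀ b ∈ H₂, ∀ g ∈ H₃, a * b * g ≠ 1 →
        (∑ M, c M * ZMod.stdAddChar
          (Matrix.trace (M * ((a * b * g : GLm p (1 + l)) : Mat p (1 + l))))) = 0)
    (hlt : budget p (1 + l) 1 (2 + ε) <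
      ((Nat.card H₁ * Nat.card H₂ * Nat.card H₃ : ℕ) : ℝ) ^ ((2 + ε) / 3)) :
    ¬diagTorus p (1 + l) ≤ H₁ ∧ ¬diagTorus p (1 + l) ≤ H₂ ∧ ¬diagTorus p (1 + l) ≤ H₃ := by
  obtain ⟨χ, hχ⟩ := exists_unitChar_ne_one (p := p) hp3
  have hσ := detChar_torus_ne_one (p := p) (m := 1 + l) (by omega) hχ
  have hν := card_admOrb_torus_le_one (p := p) (m := 1 + l) hχ
  exact ⟨fun hK => no_single_orbit_left hl hp3 hε hε1 htpp hdes hlt hK hσ hν,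
    fun hK => no_single_orbit_middle hl hp3 hε hε1 htpp hdes hlt hK hσ hν,
    fun hK => no_single_orbit_right hl hp3 hε hε1 htpp hdes hlt hK hσ hν⟩

/-- **NO MEMBER CONTAINS ANY SPLIT MAXIMAL TORUS** `x T x⁻¹` (same hypotheses). -/
theorem conjTorus_not_le_member (hl : 1 ≤ l) (hp3 : 3 ≤ p) {ε : ℝ} (hε : -2 < ε) (hε1 : ε ≤ 1)
    (htpp : SubgroupTPP H₁ H₂ H₃)
    (hdes : ∃ c : Mat p (1 + l) → ℂ, (∀ M, 1 < M.rank → c M = 0) ∧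
      (∑ M, c M * ZMod.stdAddChar (Matrix.trace (M * ((1 : GLm p (1 + l)) : Mat p (1 + l))))) = 1 ∧
      ∀ a ∈ H₁, ∀ b ∈ H₂, ∀ g ∈ H₃, a * b * g ≠ 1 →
        (∑ M, c M * ZMod.stdAddChar
          (Matrix.trace (M * ((a * b * g : GLm p (1 + l)) : Mat p (1 + l))))) = 0)
    (hlt : budget p (1 + l) 1 (2 + ε) <
      ((Nat.card H₁ * Nat.card H₂ * Nat.card H₃ : ℕ) : ℝ) ^ ((2 + ε) / 3)) (x : GLm p (1 + l)) :
    ¬conjTorus p (1 + l) x ≤ H₁ ∧ ¬conjTorus p (1 + l) x ≤ H₂ ∧ ¬conjTorus p (1 + l) x ≤ H₃ := by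
  obtain ⟨χ, hχ⟩ := exists_unitChar_ne_one (p := p) hp3
  have hσ := detChar_conjTorus_ne_one (p := p) (m := 1 + l) (by omega) hχ x
  have hν := card_admOrb_conjTorus_le_one (p := p) (m := 1 + l) hχ x
  exact ⟨fun hK => no_single_orbit_left hl hp3 hε hε1 htpp hdes hlt hK hσ hν,
    fun hK => no_single_orbit_middle hl hp3 hε hε1 htpp hdes hlt hK hσ hν,
    fun hK => no_single_orbit_right hl hp3 hε hε1 htpp hdes hlt hK hσ hν⟩

/-- Hence no member contains ANY overgroup of a split maximal torus (torus normalisers = monomial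
groups, Borel subgroups, parabolics, Levi factors, …). -/
theorem overgroup_of_torus_not_le_member (hl : 1 ≤ l) (hp3 : 3 ≤ p) {ε : ℝ} (hε : -2 < ε)
    (hε1 : ε ≤ 1) (htpp : SubgroupTPP H₁ H₂ H₃)
    (hdes : ∃ c : Mat p (1 + l) → ℂ, (∀ M, 1 < M.rank → c M = 0) ∧
      (∑ M, c M * ZMod.stdAddChar (Matrix.trace (M * ((1 : GLm p (1 + l)) : Mat p (1 + l))))) = 1 ∧
      ∀ a ∈ H₁, ∀ b ∈ H₂, ∀ g ∈ H₃, a * b * g ≠ 1 →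
        (∑ M, c M * ZMod.stdAddChar
          (Matrix.trace (M * ((a * b * g : GLm p (1 + l)) : Mat p (1 + l))))) = 0)
    (hlt : budget p (1 + l) 1 (2 + ε) <
      ((Nat.card H₁ * Nat.card H₂ * Nat.card H₃ : ℕ) : ℝ) ^ ((2 + ε) / 3))
    (x : GLm p (1 + l)) {K : Subgroup (GLm p (1 + l))} (hT : conjTorus p (1 + l) x ≤ K) :
    ¬K ≤ H₁ ∧ ¬K ≤ H₂ ∧ ¬K ≤ H₃ := by
  obtain ⟨h1, h2, h3⟩ := conjTorus_not_le_member hl hp3 hε hε1 htpp hdes hlt x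
  exact ⟨fun h => h1 (hT.trans h), fun h => h2 (hT.trans h), fun h => h3 (hT.trans h)⟩

end DiagonalTorusExclusion
end Summit.MatrixMultiplication.MatrixMultiplication.Theorems.SubgroupIdentityDesigns.Negative

end
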